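import Literature.AlgebraicGeometry.AbelianSchemes.AbelianSchemeSymplecticLevelTransfer
import Literature.AlgebraicGeometry.AbelianSchemes.AbelianSchemeIsLambdaOfAtBaseChange
import Literature.AlgebraicGeometry.AbelianSchemes.AbelianSchemeOverFibreIdentity
import Literature.AlgebraicGeometry.AbelianSchemes.LevelStructureOfTorsionBasis
import Literature.AlgebraicGeometry.Motives.AbelianVarietyWeilPairingBaseChange
import Literature.AlgebraicGeometry.Motives.AbelianVarietyTorsionPointsCountProofs
import Literature.AlgebraicGeometry.AbelianVarieties.AbelianVarietyWeilDivisorBundleDictionary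
import HarnessLib

/-!
# Symplectic liftability is decided at the identity point: a symplectic lift over `K = K̄` extends to every
# geometric point and every `Λ(𝒪(Θ))`-witness ([Lan2013PELCompactifications] Lemma 1.3.6.5/1.3.6.6;
# [MumfordAV1970] §20; [Milne1986AbelianVarieties] §16 «`ē_N` commutes with base change»)

Topic `AlgebraicGeometry/AbelianSchemes`; namespace `Literature.AlgebraicGeometry.AbelianSchemes.AbelianSchemeOver`.
Cell hodgecm-mathlib (D-0151), rung-0 U-DAG sub-row **U-a5 (symp)** (B-plan1 (g10) R75, B-plan2 (g9) 09:39:39Z / R78;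
(vii) p712366 ★): the two prover leaves that ★ D3 `AbelianSchemeSymplecticLevel`'s design record lists as owed —
«insensitivity to the algebraically closed field» and «`∀ Θ`: two ample witnesses of the same `λ̄` give the same
`ē_M`» — assembled into ONE statement.  CONSUMER: U-a — the `symplectic` FIELD
(`LevelStructure.IsSymplecticLiftable pol δ`) of the algebraic realisation `P_{Z,r}` of a Siegel point: with ★ (b)
`SiegelAdelicMarking.exists_symplecticLift_of_levelReading` producing ONE lift at the identity point of `Spec ℂ` for
ONE witness (over the sections of ★ `LevelStructureOfTorsionBasis` §4/§5), this file yields liftability at EVERY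
geometric point `Spec Ω → Spec ℂ` for EVERY witness.  THEOREMS ONLY (no definition, no named fact, no instance, no
`sorry`); books 0.  HC_CM is proved only modulo the 7 printed citations until rung 0 closes; nothing here discharges
a binder.

SETTING.  `K` algebraically closed of characteristic `0` (`K : Type`, the universe of ★ `fibreIdIso`), `A` an abelian
scheme over `Spec K` (`A₀ := A.toAffine.toAbelianVariety` the abelian variety it IS), `D` a dual pair, `λ : A → Â`
over `Spec K`, `φ` a level-`N` structure, `δ` a type; at the identity point `𝟙 : Spec K → Spec K` a divisor `Θ₁` on
the fibre `A_𝟙` with `λ̄ = Λ(𝒪(Θ₁))` there (D2 `IsLambdaOfAt`) and a symplectic lift `Λ₁` of `φ(𝟙)` for `Θ₁` (D3).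
A geometric point `s : Spec Ω → Spec K` is `Spec (K → Ω)` (Mathlib `Spec.map_surjective`), and THE FIBRE `A_s` IS
THE BASE CHANGE `A₀ ⊗_K Ω` — `(A.fibre (Spec (K → Ω))).toAbelianVariety = A₀.baseChange Ω` holds by `rfl` (§0) — so
the tree's base-change kit for abelian varieties applies to it verbatim.

* §0 `fibre_spec_algebraMap_eq_baseChange` (the `rfl`), the projection `π : A_s → A₀` and the comparison
  `π₁ = π ≫ e⁻¹ : A_s → A_𝟙` (`e = fibreIdIso`); instances (dominance);
* §1 TRANSPORT OF POINTS `T : A_𝟙(K) →* A_s(Ω)` (`= pointsMulEquiv ∘ extendScalars ∘ e`), injective, torsion to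
  torsion, «lying over» relations, and the READING `T(σ(𝟙)) = σ(s)` of sections (★ p713965 §5 + ★ `restrictPt_left_fst`);
* §2 TORSION RIGIDITY: `#A_s[M](Ω) = #A₀[M](Ω) = M^{2 dim A₀} = #A₀[M](K) ≤ #A_𝟙[M](K) = M^{2g}` (★
  `natCard_torsionPoints_baseChange`, ★ `natCard_torsionPoints_eq_of_isAlgClosed` twice, ★
  `SymplecticLift.natCard_torsionPoints`) ⇒ `T ∘ Λ₁.lift_M` is a bijection `(ℤ/M)^{2g} ⥲ A_s[M](Ω)`;
* §3 THE SLICE SQUARE `sliceAt s Q = π₁ ≫ sliceAt 𝟙 Q₁` for `Q = T Q₁` and the class identity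
  `[t_Q^*𝒪(Θ)⊗𝒪(Θ)⁻¹] = [t_Q^*𝒪(Θ_Ω)⊗𝒪(Θ_Ω)⁻¹]` at TORSION points, `Θ_Ω := π^*(e⁻¹)^*Θ₁`, from `λ̄ = Λ(𝒪(Θ))` at `s` and
  `λ̄ = Λ(𝒪(Θ₁))` at `𝟙` (class bookkeeping as in ★ `IsLambdaOfAt.baseChange`; NO claim that `Θ_Ω` is a `Λ`-witness at
  the non-`K`-rational points of `A_s`);
* §4 THE PAIRING: `ē^Θ_M(T P₁, T Q₁) = ē^{Θ_Ω}_M(T P₁, T Q₁)` (★ `weilPairingLevel_eq_of_nonempty_translateTensorDual_iso`)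
  `= (K → Ω)(ē^{(e⁻¹)^*Θ₁}_M(e P₁, e Q₁))` (★ `weilPairingLevel_baseChange`) `= (K → Ω)(ē^{Θ₁}_M(P₁, Q₁))`
  (★ `weilPairingLevel_pullback_eq`) `= (K → Ω)(ζ_M)^{E_δ(x,y)}`;
* §5 HEAD **`LevelStructure.SymplecticLift.nonempty_of_identityFibre`** and **`LevelStructure.isSymplecticLiftable_of_identityFibre`**.

## References
* [Lan2013PELCompactifications] K.-W. Lan, *Arithmetic compactifications of PEL-type Shimura varieties* (2013), §1.3.6
  Def. 1.3.6.2 (p. 80), Lemma 1.3.6.5, Lemma 1.3.6.6, Cor. 1.3.6.7 (pp. 81–82).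
* [MumfordAV1970] D. Mumford, *Abelian Varieties* (1970), §6 Application 3 (Proposition p. 64), §20 (p. 186).
* [Milne1986AbelianVarieties] J. S. Milne, *Abelian varieties*, in Cornell–Silverman (1986), §16 (p. 131).
* [Lang1983AbelianVarieties] S. Lang, *Abelian Varieties*, Ch. VII §2 Prop. 3.
* [MumfordFogartyKirwan1994] D. Mumford, J. Fogarty, F. Kirwan, *Geometric Invariant Theory*, 3rd ed. (1994), Ch. 6 §2
  Def. 6.2–6.3 (p. 120), Ch. 7 §2 Def. 7.1–7.3 (p. 129).
-/

set_option autoImplicit false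

noncomputable section

open CategoryTheory CategoryTheory.Limits AlgebraicGeometry MonoidalCategory

namespace Literature.AlgebraicGeometry.AbelianSchemes

namespace AbelianSchemeOver

open Literature.AlgebraicGeometry.Motives Literature.AlgebraicGeometry.Modules
  Literature.AlgebraicGeometry.AbelianVarieties
open scoped MonObj


universe v in
/-- `(f ≫ g)^* = f^* ∘ g^*` on `Ȟ¹(-, 𝒪^×)` (through ★ `detClass_pullback` and Mathlib `Scheme.Modules.pullbackComp`; the
tree's `CechPic.pullback_comp` (`Modules/UnitCocyclePresented`) lies outside this file's import cone, hence this private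
copy, exactly as in ★ `AbelianSchemeIsLambdaOfAtBaseChange`). [cite: Hartshorne1977, II Ex. 6.8 (a)] -/
private theorem cechPic_pullback_comp' {X Y Z : Scheme.{v}} (f : X ⟶ Y) (g : Y ⟶ Z) (c₀ : CechPic Z) :
    CechPic.pullback (f ≫ g) c₀ = CechPic.pullback f (CechPic.pullback g c₀) := by
  obtain ⟨c, rfl⟩ := CechPic.mk_surjective c₀
  have hE := c.isFiniteLocallyFree_lineBundle
  rw [← c.detClass_lineBundle, ← detClass_pullback, ← detClass_pullback, ← detClass_pullback]
  exact detClass_eq_of_iso ((Scheme.Modules.pullbackComp f g).app (lineBundle c)).symm _ _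

variable {K : Type} [Field K] (A : AbelianSchemeOver (Spec (.of K)))

/-! ### §0. The geometric fibre `A_{Spec (K → Ω)}` IS the base change `A₀ ⊗_K Ω`; the identity-fibre iso `e` -/

section Fibre

variable (Ω : Type) [Field Ω] [Algebra K Ω]

/-- **`A_{Spec (K → Ω)} = A₀ ⊗_K Ω` on the nose**: the fibre of the abelian scheme `A/Spec K` at the geometric point
`Spec (algebraMap K Ω)` and the base change of the abelian variety `A₀ = A.toAffine.toAbelianVariety` to `Ω` are the
same record (both are `Over.pullback (Spec (K → Ω))` with the transported group law). [cite: GortzWedhorn2020, Section (4.7) (pp. 107–108)] -/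
theorem fibre_spec_algebraMap_eq_baseChange :
    (A.fibre (Spec.map (CommRingCat.ofHom (algebraMap K Ω)))).toAbelianVariety =
      A.toAffine.toAbelianVariety.baseChange Ω :=
  rfl

/-- The same for `ofAbelianVariety A₀`: its fibre at `Spec (K → Ω)` is `A₀ ⊗_K Ω`. [cite: GortzWedhorn2020, Section (4.7) (pp. 107–108)] -/
theorem fibre_ofAbelianVariety_spec_algebraMap_eq_baseChange (A₀ : AbelianVariety K) :
    ((ofAbelianVariety A₀).fibre (Spec.map (CommRingCat.ofHom (algebraMap K Ω)))).toAbelianVariety = A₀.baseChange Ω :=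
  rfl

/-- The projection `π : A_s = A₀ ⊗_K Ω → A₀` is dominant. [cite: GortzWedhorn2020, Section (4.7) and Prop. 4.16] -/
theorem isDominant_fibreFst
    (π : (A.fibre (Spec.map (CommRingCat.ofHom (algebraMap K Ω)))).toAbelianVariety.X.left ⟶
      A.toAffine.toAbelianVariety.X.left)
    (hπ : π = pullback.fst A.X.hom (Spec.map (CommRingCat.ofHom (algebraMap K Ω)))) : IsDominant π := by
  rw [hπ]
  exact AbelianVariety.isDominant_baseChangeFst Ω A.toAffine.toAbelianVariety

end Fibre

/-- `e⁻¹ : A₀ → A_𝟙` (inverse of the identity-fibre isomorphism) is dominant. [cite: GortzWedhorn2020, Section (4.7) (pp. 107–108)] -/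
theorem isDominant_toSchemeHom_fibreIdIso_inv :
    IsDominant (AbelianVariety.Hom.toSchemeHom (fibreIdIso A).inv) :=
  AbelianVariety.isDominant_toSchemeHom_iso_hom (fibreIdIso A).symm

/-- `e⁻¹ ≫ pr₁ = 𝟙` on underlying schemes (`pr₁ : A ×_S S → A` is the underlying map of `e`).
[cite: GortzWedhorn2020, Section (4.7) (pp. 107–108)] -/
theorem toSchemeHom_fibreIdIso_inv_comp_fst :
    AbelianVariety.Hom.toSchemeHom (fibreIdIso A).inv ≫ pullback.fst A.X.hom (𝟙 (Spec (.of K))) = 𝟙 _ :=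
  fibreIdToGrpIso_inv_left_fst A

/-- `(e P).left = P.left ≫ pr₁` for a point `P` of the identity fibre. [cite: GortzWedhorn2020, Section (4.7) (pp. 107–108)] -/
theorem map_fibreIdIso_hom_left {L : Type} [Field L] [Algebra K L]
    (P : (A.fibre (𝟙 (Spec (.of K)))).toAbelianVariety.Points L) :
    (AlgPoints.map (fibreIdIso A).hom.hom.hom.hom P).left = P.left ≫ pullback.fst A.X.hom (𝟙 (Spec (.of K))) := by
  rw [AlgPoints.map_apply, Over.comp_left, fibreIdIso_hom_hom, ← fibreIdToGrpIso_hom_left]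
  rfl

/-- `e⁻¹ (e P) = P` on points. [cite: GortzWedhorn2020, Section (4.7) (pp. 107–108)] -/
theorem map_fibreIdIso_inv_map_hom {L : Type} [Field L] [Algebra K L]
    (P : (A.fibre (𝟙 (Spec (.of K)))).toAbelianVariety.Points L) :
    AlgPoints.map (fibreIdIso A).inv.hom.hom.hom (AlgPoints.map (fibreIdIso A).hom.hom.hom.hom P) = P := by
  rw [← AlgPoints.map_comp_apply]
  change AlgPoints.map ((fibreIdIso A).hom ≫ (fibreIdIso A).inv).hom.hom.hom P = P
  rw [(fibreIdIso A).hom_inv_id]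
  exact AlgPoints.map_id_apply P

/-- `e (e⁻¹ Q) = Q` on points. [cite: GortzWedhorn2020, Section (4.7) (pp. 107–108)] -/
theorem map_fibreIdIso_hom_map_inv {L : Type} [Field L] [Algebra K L]
    (Q : A.toAffine.toAbelianVariety.Points L) :
    AlgPoints.map (fibreIdIso A).hom.hom.hom.hom (AlgPoints.map (fibreIdIso A).inv.hom.hom.hom Q) = Q := by
  rw [← AlgPoints.map_comp_apply]
  change AlgPoints.map ((fibreIdIso A).inv ≫ (fibreIdIso A).hom).hom.hom.hom Q = Q
  rw [(fibreIdIso A).inv_hom_id]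
  exact AlgPoints.map_id_apply Q

/-- `e` is injective on points. [cite: GortzWedhorn2020, Section (4.7) (pp. 107–108)] -/
theorem map_fibreIdIso_hom_injective {L : Type} [Field L] [Algebra K L] :
    Function.Injective fun P : (A.fibre (𝟙 (Spec (.of K)))).toAbelianVariety.Points L =>
      AlgPoints.map (fibreIdIso A).hom.hom.hom.hom P := fun P Q h => by
  have h' := congrArg (AlgPoints.map (fibreIdIso A).inv.hom.hom.hom) h
  dsimp only at h'
  rwa [map_fibreIdIso_inv_map_hom, map_fibreIdIso_inv_map_hom] at h'

/-- `e⁻¹` is injective on points. [cite: GortzWedhorn2020, Section (4.7) (pp. 107–108)] -/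
theorem map_fibreIdIso_inv_injective {L : Type} [Field L] [Algebra K L] :
    Function.Injective fun Q : A.toAffine.toAbelianVariety.Points L =>
      AlgPoints.map (fibreIdIso A).inv.hom.hom.hom Q := fun P Q h => by
  have h' := congrArg (AlgPoints.map (fibreIdIso A).hom.hom.hom.hom) h
  dsimp only at h'
  rwa [map_fibreIdIso_hom_map_inv, map_fibreIdIso_hom_map_inv] at h'

/-! ### §1. Transport of points `A_𝟙(K) → A_s(Ω)` and the reading of sections -/

section Transport

variable (Ω : Type) [Field Ω] [Algebra K Ω]

/-- **THE TRANSPORT OF POINTS `T : A_𝟙(K) →* A_s(Ω)`** (`T = pointsMulEquiv ∘ extendScalars ∘ e`): a group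
homomorphism from the `K`-points of the identity fibre to the `Ω`-points of the fibre at `Spec (K → Ω)`, INJECTIVE,
such that `T P₁` LIES OVER `e P₁` (`(T P₁) ≫ pr₁ = Spec (K → Ω) ≫ (e P₁)`) — stated as an existence so that no
definition is introduced. [cite: GortzWedhorn2020, Section (4.7) (points of a base change)] [cite: Hartshorne1977, II Ex. 2.7] -/
theorem exists_transport :
    ∃ T : (A.fibre (𝟙 (Spec (.of K)))).toAbelianVariety.Points K →*
        (A.fibre (Spec.map (CommRingCat.ofHom (algebraMap K Ω)))).toAbelianVariety.Points Ω,
      Function.Injective T ∧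
      ∀ P₁, (T P₁).left ≫ pullback.fst A.X.hom (Spec.map (CommRingCat.ofHom (algebraMap K Ω))) =
        Spec.map (CommRingCat.ofHom (algebraMap K Ω)) ≫ (AlgPoints.map (fibreIdIso A).hom.hom.hom.hom P₁).left := by
  let A₀ := A.toAffine.toAbelianVariety
  let E₁ : (A.fibre (𝟙 (Spec (.of K)))).toAbelianVariety.Points K →* A₀.Points K :=
    IsMonHom.monoidHom (fibreIdIso A).hom.hom.hom.hom (specOver K K)
  let E₂ : A₀.Points K →* A₀.Points Ω := AlgPoints.extendScalarsMonoidHom A₀.X K Ω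
  let E₃ : A₀.Points Ω →* (A₀.baseChange Ω).Points Ω := (A₀.pointsMulEquiv Ω).toMonoidHom
  have hE₁ : ∀ P, E₁ P = AlgPoints.map (fibreIdIso A).hom.hom.hom.hom P := fun P => rfl
  refine ⟨E₃.comp (E₂.comp E₁), ?_, fun P₁ => ?_⟩
  · exact (A₀.pointsMulEquiv Ω).injective.comp
      ((AlgPoints.extendScalars_injective A₀.X K Ω).comp A.map_fibreIdIso_hom_injective)
  · have hs : (AlgPoints.extendScalars A₀.X K Ω (E₁ P₁)).left = AbelianVariety.bcSpec K Ω ≫ (E₁ P₁).left := by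
      rw [AlgPoints.extendScalars_apply, Over.comp_left, AlgPoints.specOverMap_left]
      rfl
    exact A₀.pointsMulEquiv_left_comp_eq Ω (AlgPoints.extendScalars A₀.X K Ω (E₁ P₁)) (E₁ P₁) hs

variable {Ω}

/-- Transport maps `M`-torsion to `M`-torsion (it is a homomorphism). [cite: MumfordAV1970, §4 (Cor. 1 of the rigidity lemma)] -/
theorem transport_mem_torsionPoints
    (T : (A.fibre (𝟙 (Spec (.of K)))).toAbelianVariety.Points K →*
      (A.fibre (Spec.map (CommRingCat.ofHom (algebraMap K Ω)))).toAbelianVariety.Points Ω)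
    {M : ℤ} {P : (A.fibre (𝟙 (Spec (.of K)))).toAbelianVariety.Points K}
    (hP : P ∈ (A.fibre (𝟙 (Spec (.of K)))).toAbelianVariety.torsionPoints K M) :
    T P ∈ (A.fibre (Spec.map (CommRingCat.ofHom (algebraMap K Ω)))).toAbelianVariety.torsionPoints Ω M := by
  rw [AbelianVariety.mem_torsionPoints_iff] at hP ⊢
  rw [← map_zpow, hP, map_one]

/-- **READING OF SECTIONS**: a transport `T` lying over `e` carries `σ(𝟙)` to `σ(s)` for every section `σ` of `A` —
both are `Ω`-points of `A_s` with first projection `Spec (K → Ω) ≫ σ` (★ `restrictPt_left_fst`, ★ p713965 §5) and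
second projection `𝟙`. [cite: MumfordFogartyKirwan1994, Ch. 7 §2 Definition 7.1 (p. 129) and Definition 7.3 (p. 129)] -/
theorem transport_restrictPt_id
    (T : (A.fibre (𝟙 (Spec (.of K)))).toAbelianVariety.Points K →*
      (A.fibre (Spec.map (CommRingCat.ofHom (algebraMap K Ω)))).toAbelianVariety.Points Ω)
    (hT : ∀ P₁, (T P₁).left ≫ pullback.fst A.X.hom (Spec.map (CommRingCat.ofHom (algebraMap K Ω))) =
      Spec.map (CommRingCat.ofHom (algebraMap K Ω)) ≫ (AlgPoints.map (fibreIdIso A).hom.hom.hom.hom P₁).left)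
    (σ : A.Sections) :
    T (A.restrictPt (𝟙 (Spec (.of K))) σ) = A.restrictPt (Spec.map (CommRingCat.ofHom (algebraMap K Ω))) σ := by
  -- the `K`-point of `A₀` underlying `σ`
  obtain ⟨P, hP⟩ := exists_point_left_eq A.toAffine.toAbelianVariety σ
  have hread : AlgPoints.map (fibreIdIso A).hom.hom.hom.hom (A.restrictPt (𝟙 (Spec (.of K))) σ) = P :=
    map_fibreIdIso_restrictPt_id_of_left_eq A.toAffine.toAbelianVariety hP.symm
  apply Over.OverMorphism.ext
  apply pullback.hom_ext
  · refine (hT _).trans ?_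
    rw [hread, hP]
    exact (A.restrictPt_left_fst _ σ).symm
  · exact (A.fibrePoint_left_comp_snd _ (T _)).trans (A.restrictPt_left_snd _ σ).symm

end Transport

/-! ### §2. Torsion rigidity: `#A_s[M](Ω) = M^{2 dim A₀} ≤ M^{2g}` -/

section Rigidity

variable {A} {g N : ℕ} {φ : A.LevelStructure g N} {δ : Fin g → ℕ}
  {Θ₁ : CartierDivisor (A.fibre (𝟙 (Spec (.of K)))).toAbelianVariety.X.left}
  {Ω : Type} [Field Ω] [Algebra K Ω]

variable (A) in
/-- **`#A_s[M](Ω) = M^{2 dim A₀}`**: `#A_s[M](Ω) = #A₀[M](Ω)` (★ `natCard_torsionPoints_baseChange`, §0) `= M^{2 dim A₀}`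
(★ `natCard_torsionPoints_eq_of_isAlgClosed` over `Ω`). [cite: MumfordAV1970, §6 Application 3 (Proposition p. 64)] -/
theorem natCard_torsionPoints_fibre_eq [CharZero K] [IsAlgClosed Ω] {M : ℕ} (hM₀ : M ≠ 0) :
    Nat.card ((A.fibre (Spec.map (CommRingCat.ofHom (algebraMap K Ω)))).toAbelianVariety.torsionPoints Ω (M : ℤ)) =
      M ^ (2 * A.toAffine.toAbelianVariety.dim) := by
  have hMK : ((M : ℤ) : K) ≠ 0 := by exact_mod_cast hM₀
  change Nat.card ((A.toAffine.toAbelianVariety.baseChange Ω).torsionPoints Ω (M : ℤ)) = _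
  rw [A.toAffine.toAbelianVariety.natCard_torsionPoints_baseChange Ω,
    A.toAffine.toAbelianVariety.natCard_torsionPoints_eq_of_isAlgClosed Ω (M : ℤ) hMK]
  simp

/-- **`#A_s[M](Ω) ≤ M^{2g}`** (in fact `=`): `M^{2 dim A₀} = #A₀[M](K)` (★ count over `K = K̄`) `≤ #A_𝟙[M](K)` (the
injection `e⁻¹`) `= M^{2g}` (★ `SymplecticLift.natCard_torsionPoints`); this is where `IsAlgClosed K` and `CharZero K`
enter. [cite: MumfordAV1970, §6 Application 3 (Proposition p. 64)] -/
theorem natCard_torsionPoints_fibre_le [IsAlgClosed K] [CharZero K] [IsAlgClosed Ω]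
    (Λ₁ : φ.SymplecticLift (𝟙 (Spec (.of K))) Θ₁ δ) {M : ℕ} (hM : N ∣ M) (hM₀ : M ≠ 0) :
    Nat.card ((A.fibre (Spec.map (CommRingCat.ofHom (algebraMap K Ω)))).toAbelianVariety.torsionPoints Ω (M : ℤ)) ≤
      M ^ (2 * g) := by
  have hMK : ((M : ℤ) : K) ≠ 0 := by exact_mod_cast hM₀
  have hK : Nat.card (A.toAffine.toAbelianVariety.torsionPoints K (M : ℤ)) = M ^ (2 * A.toAffine.toAbelianVariety.dim) := by
    rw [A.toAffine.toAbelianVariety.natCard_torsionPoints_eq_of_isAlgClosed K (M : ℤ) hMK]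
    simp
  rw [A.natCard_torsionPoints_fibre_eq hM₀, ← hK, ← Λ₁.natCard_torsionPoints hM hM₀]
  -- `e⁻¹ : A₀[M](K) ↪ A_𝟙[M](K)`
  haveI : Finite ((A.fibre (𝟙 (Spec (.of K)))).toAbelianVariety.torsionPoints K (M : ℤ)) := by
    apply Nat.finite_of_card_ne_zero
    rw [Λ₁.natCard_torsionPoints hM hM₀]
    exact pow_ne_zero _ hM₀
  refine Nat.card_le_card_of_injective
    (fun Q => ⟨AlgPoints.map (fibreIdIso A).inv.hom.hom.hom Q.1, AbelianVariety.map_mem_torsionPoints _ Q.2⟩) ?_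
  intro Q Q' h
  exact Subtype.ext (A.map_fibreIdIso_inv_injective (congrArg Subtype.val h))

end Rigidity

/-! ### §3. The slice square and the class of `t_Q^*𝒪(Θ) ⊗ 𝒪(Θ)⁻¹` at a transported torsion point -/

section Slice

variable (D : A.DualPair) (lam : A.X ⟶ D.hat.X) {Ω : Type} [Field Ω] [Algebra K Ω]

/-- **`λ̄(Q) = Spec (K → Ω) ≫ λ̄(Q₁)`** for `Q` lying over `e Q₁`. [cite: MumfordFogartyKirwan1994, Ch. 6 §2 Definition 6.3 (p. 120)] -/
theorem valueAt_eq_of_over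
    (Q : (A.fibre (Spec.map (CommRingCat.ofHom (algebraMap K Ω)))).toAbelianVariety.Points Ω)
    (Q₁ : (A.fibre (𝟙 (Spec (.of K)))).toAbelianVariety.Points K)
    (hQ : Q.left ≫ pullback.fst A.X.hom (Spec.map (CommRingCat.ofHom (algebraMap K Ω))) =
      Spec.map (CommRingCat.ofHom (algebraMap K Ω)) ≫ (AlgPoints.map (fibreIdIso A).hom.hom.hom.hom Q₁).left) :
    A.valueAt (Spec.map (CommRingCat.ofHom (algebraMap K Ω))) D lam Q =
      Spec.map (CommRingCat.ofHom (algebraMap K Ω)) ≫ A.valueAt (𝟙 (Spec (.of K))) D lam Q₁ := by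
  have hQ' : A.fibrePointToLeft (Spec.map (CommRingCat.ofHom (algebraMap K Ω))) Q =
      Spec.map (CommRingCat.ofHom (algebraMap K Ω)) ≫ A.fibrePointToLeft (𝟙 (Spec (.of K))) Q₁ := by
    have h := hQ
    rw [map_fibreIdIso_hom_left] at h
    exact h
  change A.fibrePointToLeft _ Q ≫ lam.left = Spec.map (CommRingCat.ofHom (algebraMap K Ω)) ≫
    A.fibrePointToLeft (𝟙 (Spec (.of K))) Q₁ ≫ lam.left
  rw [hQ', Category.assoc]

/-- **THE SLICE SQUARE**: `slice_s(Q) = π₁ ≫ slice_𝟙(Q₁)` with `π₁ = pr₁ ≫ e⁻¹ : A_s → A_𝟙`, for `Q` lying over `e Q₁`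
(both components agree: `pr₁` and `Spec(K → Ω) ≫ λ̄(Q₁) ∘ pr₂`). [cite: MumfordFogartyKirwan1994, Ch. 6 §2 Definition 6.2 (p. 120)] -/
theorem sliceAt_eq_comp_sliceAt_id
    (π : (A.fibre (Spec.map (CommRingCat.ofHom (algebraMap K Ω)))).toAbelianVariety.X.left ⟶
      A.toAffine.toAbelianVariety.X.left)
    (hπ : π = pullback.fst A.X.hom (Spec.map (CommRingCat.ofHom (algebraMap K Ω))))
    (Q : (A.fibre (Spec.map (CommRingCat.ofHom (algebraMap K Ω)))).toAbelianVariety.Points Ω)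
    (Q₁ : (A.fibre (𝟙 (Spec (.of K)))).toAbelianVariety.Points K)
    (hQ : Q.left ≫ pullback.fst A.X.hom (Spec.map (CommRingCat.ofHom (algebraMap K Ω))) =
      Spec.map (CommRingCat.ofHom (algebraMap K Ω)) ≫ (AlgPoints.map (fibreIdIso A).hom.hom.hom.hom Q₁).left) :
    A.sliceAt (Spec.map (CommRingCat.ofHom (algebraMap K Ω))) D lam Q =
      (π ≫ AbelianVariety.Hom.toSchemeHom (fibreIdIso A).inv) ≫ A.sliceAt (𝟙 (Spec (.of K))) D lam Q₁ := by
  subst hπ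
  -- `π₁ ≫ pr₁ = pr₁`
  have hfst : (pullback.fst A.X.hom (Spec.map (CommRingCat.ofHom (algebraMap K Ω))) ≫
      AbelianVariety.Hom.toSchemeHom (fibreIdIso A).inv) ≫ pullback.fst A.X.hom (𝟙 (Spec (.of K))) =
      pullback.fst A.X.hom (Spec.map (CommRingCat.ofHom (algebraMap K Ω))) := by
    refine (Category.assoc _ _ _).trans ?_
    erw [A.toSchemeHom_fibreIdIso_inv_comp_fst]
    exact Category.comp_id _
  -- `pr₂ = pr₁ ≫ (A → Spec K)` on the identity fibre
  have hsnd₁ : pullback.snd A.X.hom (𝟙 (Spec (.of K))) = pullback.fst A.X.hom (𝟙 (Spec (.of K))) ≫ A.X.hom := by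
    rw [pullback.condition, Category.comp_id]
  -- `π₁ ≫ pr₂ = pr₂ ≫ Spec (K → Ω)`
  have hsnd : (pullback.fst A.X.hom (Spec.map (CommRingCat.ofHom (algebraMap K Ω))) ≫
      AbelianVariety.Hom.toSchemeHom (fibreIdIso A).inv) ≫ pullback.snd A.X.hom (𝟙 (Spec (.of K))) =
      pullback.snd A.X.hom (Spec.map (CommRingCat.ofHom (algebraMap K Ω))) ≫
        Spec.map (CommRingCat.ofHom (algebraMap K Ω)) := by
    rw [hsnd₁, ← pullback.condition]
    exact (Category.assoc _ _ _).symm.trans (congrArg (· ≫ A.X.hom) hfst)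
  apply pullback.hom_ext
  · calc A.sliceAt (Spec.map (CommRingCat.ofHom (algebraMap K Ω))) D lam Q ≫ pullback.fst A.X.hom D.hat.X.hom
        = pullback.fst A.X.hom (Spec.map (CommRingCat.ofHom (algebraMap K Ω))) := A.sliceAt_fst _ D lam Q
      _ = (pullback.fst A.X.hom (Spec.map (CommRingCat.ofHom (algebraMap K Ω))) ≫
            AbelianVariety.Hom.toSchemeHom (fibreIdIso A).inv) ≫ pullback.fst A.X.hom (𝟙 (Spec (.of K))) := hfst.symm
      _ = (pullback.fst A.X.hom (Spec.map (CommRingCat.ofHom (algebraMap K Ω))) ≫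
            AbelianVariety.Hom.toSchemeHom (fibreIdIso A).inv) ≫
            (A.sliceAt (𝟙 (Spec (.of K))) D lam Q₁ ≫ pullback.fst A.X.hom D.hat.X.hom) :=
          congrArg (fun k => (pullback.fst A.X.hom (Spec.map (CommRingCat.ofHom (algebraMap K Ω))) ≫
            AbelianVariety.Hom.toSchemeHom (fibreIdIso A).inv) ≫ k) (A.sliceAt_fst (𝟙 (Spec (.of K))) D lam Q₁).symm
      _ = ((pullback.fst A.X.hom (Spec.map (CommRingCat.ofHom (algebraMap K Ω))) ≫
            AbelianVariety.Hom.toSchemeHom (fibreIdIso A).inv) ≫ A.sliceAt (𝟙 (Spec (.of K))) D lam Q₁) ≫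
            pullback.fst A.X.hom D.hat.X.hom := (Category.assoc _ _ _).symm
  · calc A.sliceAt (Spec.map (CommRingCat.ofHom (algebraMap K Ω))) D lam Q ≫ pullback.snd A.X.hom D.hat.X.hom
        = pullback.snd A.X.hom (Spec.map (CommRingCat.ofHom (algebraMap K Ω))) ≫
            A.valueAt (Spec.map (CommRingCat.ofHom (algebraMap K Ω))) D lam Q := A.sliceAt_snd _ D lam Q
      _ = pullback.snd A.X.hom (Spec.map (CommRingCat.ofHom (algebraMap K Ω))) ≫
            (Spec.map (CommRingCat.ofHom (algebraMap K Ω)) ≫ A.valueAt (𝟙 (Spec (.of K))) D lam Q₁) := by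
          rw [A.valueAt_eq_of_over D lam Q Q₁ hQ]
      _ = (pullback.snd A.X.hom (Spec.map (CommRingCat.ofHom (algebraMap K Ω))) ≫
            Spec.map (CommRingCat.ofHom (algebraMap K Ω))) ≫ A.valueAt (𝟙 (Spec (.of K))) D lam Q₁ :=
          (Category.assoc _ _ _).symm
      _ = ((pullback.fst A.X.hom (Spec.map (CommRingCat.ofHom (algebraMap K Ω))) ≫
            AbelianVariety.Hom.toSchemeHom (fibreIdIso A).inv) ≫ pullback.snd A.X.hom (𝟙 (Spec (.of K)))) ≫
            A.valueAt (𝟙 (Spec (.of K))) D lam Q₁ := by rw [hsnd]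
      _ = (pullback.fst A.X.hom (Spec.map (CommRingCat.ofHom (algebraMap K Ω))) ≫
            AbelianVariety.Hom.toSchemeHom (fibreIdIso A).inv) ≫
            (pullback.snd A.X.hom (𝟙 (Spec (.of K))) ≫ A.valueAt (𝟙 (Spec (.of K))) D lam Q₁) := Category.assoc _ _ _
      _ = (pullback.fst A.X.hom (Spec.map (CommRingCat.ofHom (algebraMap K Ω))) ≫
            AbelianVariety.Hom.toSchemeHom (fibreIdIso A).inv) ≫
            (A.sliceAt (𝟙 (Spec (.of K))) D lam Q₁ ≫ pullback.snd A.X.hom D.hat.X.hom) :=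
          congrArg (fun k => (pullback.fst A.X.hom (Spec.map (CommRingCat.ofHom (algebraMap K Ω))) ≫
            AbelianVariety.Hom.toSchemeHom (fibreIdIso A).inv) ≫ k) (A.sliceAt_snd (𝟙 (Spec (.of K))) D lam Q₁).symm
      _ = ((pullback.fst A.X.hom (Spec.map (CommRingCat.ofHom (algebraMap K Ω))) ≫
            AbelianVariety.Hom.toSchemeHom (fibreIdIso A).inv) ≫ A.sliceAt (𝟙 (Spec (.of K))) D lam Q₁) ≫
            pullback.snd A.X.hom D.hat.X.hom := (Category.assoc _ _ _).symm

/-- **The class of the `𝒫`-slice at `Q` is `π₁^*` of the class of the `𝒫`-slice at `Q₁`** (the slice square and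
`(f ≫ g)^* ≅ f^* g^*`; any local-freeness witnesses). [cite: MumfordFogartyKirwan1994, Ch. 6 §2 Definition 6.2 (p. 120)]
[cite: Hartshorne1977, II Ex. 6.8 (a)] -/
theorem detClass_slicePullback_eq_of_over
    (π : (A.fibre (Spec.map (CommRingCat.ofHom (algebraMap K Ω)))).toAbelianVariety.X.left ⟶
      A.toAffine.toAbelianVariety.X.left)
    (hπ : π = pullback.fst A.X.hom (Spec.map (CommRingCat.ofHom (algebraMap K Ω))))
    (Q : (A.fibre (Spec.map (CommRingCat.ofHom (algebraMap K Ω)))).toAbelianVariety.Points Ω)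
    (Q₁ : (A.fibre (𝟙 (Spec (.of K)))).toAbelianVariety.Points K)
    (hQ : Q.left ≫ pullback.fst A.X.hom (Spec.map (CommRingCat.ofHom (algebraMap K Ω))) =
      Spec.map (CommRingCat.ofHom (algebraMap K Ω)) ≫ (AlgPoints.map (fibreIdIso A).hom.hom.hom.hom Q₁).left)
    (hW : IsFiniteLocallyFree ((Scheme.Modules.pullback
      (A.sliceAt (Spec.map (CommRingCat.ofHom (algebraMap K Ω))) D lam Q)).obj D.P))
    (hW₁ : IsFiniteLocallyFree ((Scheme.Modules.pullback (A.sliceAt (𝟙 (Spec (.of K))) D lam Q₁)).obj D.P)) :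
    detClass hW = CechPic.pullback (π ≫ AbelianVariety.Hom.toSchemeHom (fibreIdIso A).inv) (detClass hW₁) :=
  have j : (Scheme.Modules.pullback (A.sliceAt (Spec.map (CommRingCat.ofHom (algebraMap K Ω))) D lam Q)).obj D.P ≅
      (Scheme.Modules.pullback (π ≫ AbelianVariety.Hom.toSchemeHom (fibreIdIso A).inv)).obj
        ((Scheme.Modules.pullback (A.sliceAt (𝟙 (Spec (.of K))) D lam Q₁)).obj D.P) :=
    (Scheme.Modules.pullbackCongr (A.sliceAt_eq_comp_sliceAt_id D lam π hπ Q Q₁ hQ)).app D.P ≪≫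
      ((Scheme.Modules.pullbackComp _ _).app D.P).symm
  (detClass_eq_of_iso j hW (hW₁.pullback _)).trans (detClass_pullback _ hW₁)

/-- **Translation square for `π₁`**: `t_Q ≫ π₁ = π₁ ≫ t_{Q₁}` for `Q` lying over `e Q₁` (`t_Q ≫ pr₁ = pr₁ ≫ t_{eQ₁}` on the
base change, ★ `translation_left_comp_baseChangeFst`, then `t_{eQ₁} ≫ e⁻¹ = e⁻¹ ≫ t_{Q₁}`, ★ `translation_left_comp_toSchemeHom`);
`π` is passed as a variable typed on the abelian varieties with its defining equation, as in ★ `AbelianVarietyWeilPairingBaseChange`.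
[cite: GortzWedhorn2023, Def./Rem. 27.1 (p. 604)] -/
theorem translation_left_comp_pi
    (π : (A.fibre (Spec.map (CommRingCat.ofHom (algebraMap K Ω)))).toAbelianVariety.X.left ⟶
      A.toAffine.toAbelianVariety.X.left)
    (hπ : π = pullback.fst A.X.hom (Spec.map (CommRingCat.ofHom (algebraMap K Ω))))
    (Q : (A.fibre (Spec.map (CommRingCat.ofHom (algebraMap K Ω)))).toAbelianVariety.Points Ω)
    (Q₁ : (A.fibre (𝟙 (Spec (.of K)))).toAbelianVariety.Points K)
    (hQ : Q.left ≫ pullback.fst A.X.hom (Spec.map (CommRingCat.ofHom (algebraMap K Ω))) =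
      Spec.map (CommRingCat.ofHom (algebraMap K Ω)) ≫ (AlgPoints.map (fibreIdIso A).hom.hom.hom.hom Q₁).left) :
    ((A.fibre (Spec.map (CommRingCat.ofHom (algebraMap K Ω)))).toAbelianVariety.translation Q).left ≫
        (π ≫ AbelianVariety.Hom.toSchemeHom (fibreIdIso A).inv) =
      (π ≫ AbelianVariety.Hom.toSchemeHom (fibreIdIso A).inv) ≫
        ((A.fibre (𝟙 (Spec (.of K)))).toAbelianVariety.translation Q₁).left := by
  -- on the base change: `t_Q ≫ pr₁ = pr₁ ≫ t_{eQ₁}`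
  have hQπ : Q.left ≫ π = AbelianVariety.bcSpec K Ω ≫ (AlgPoints.map (fibreIdIso A).hom.hom.hom.hom Q₁).left := by
    rw [hπ]; exact hQ
  have h1 : ((A.fibre (Spec.map (CommRingCat.ofHom (algebraMap K Ω)))).toAbelianVariety.translation Q).left ≫ π =
      π ≫ (A.toAffine.toAbelianVariety.translation (AlgPoints.map (fibreIdIso A).hom.hom.hom.hom Q₁)).left :=
    A.toAffine.toAbelianVariety.translation_left_comp_baseChangeFst Ω π hπ Q _ hQπ
  -- along `e⁻¹`: `t_{eQ₁} ≫ e⁻¹ = e⁻¹ ≫ t_{e⁻¹ e Q₁} = e⁻¹ ≫ t_{Q₁}`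
  have h2 := AbelianVariety.translation_left_comp_toSchemeHom (fibreIdIso A).inv
    (AlgPoints.map (fibreIdIso A).hom.hom.hom.hom Q₁)
  rw [map_fibreIdIso_inv_map_hom] at h2
  simp only [Category.assoc]
  rw [reassoc_of% h1, h2]

variable {A}

/-- **CLASS IDENTITY AT A TRANSPORTED POINT.**  Let `λ̄ = Λ(𝒪(Θ₁))` at `𝟙` and `λ̄ = Λ(𝒪(Θ))` at `s = Spec (K → Ω)`, and let
`Θ'` be ANY divisor on `A_s` whose class is `π₁^*[Θ₁]` (`π₁ = π ≫ e⁻¹`; e.g. `Θ' = π^*((e⁻¹)^*Θ₁)`).  Then for every `Q`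
lying over `e Q₁`, `t_Q^*𝒪(Θ) ⊗ 𝒪(Θ)⁻¹ ≅ t_Q^*𝒪(Θ') ⊗ 𝒪(Θ')⁻¹`: both have class `t_Q^*[Θ']·[Θ']⁻¹ =
π₁^*(t_{Q₁}^*[Θ₁]·[Θ₁]⁻¹) = π₁^*[𝒫|slice_𝟙(Q₁)] = [𝒫|slice_s(Q)]` (§3 square; ★ `detClass_translationPullback_tensor_dual`,
`(f ≫ g)^* = f^* ∘ g^*`; rank-one modules with equal class are isomorphic, ★ `nonempty_iso_iff_detClass_eq`).  NOTE:
nothing is claimed about `Θ'` at the other `Ω`-points of `A_s` (it need not be a `Λ`-witness there).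
[cite: MumfordFogartyKirwan1994, Ch. 6 §2 Definition 6.2–6.3 (p. 120)] [cite: Hartshorne1977, III Ex. 4.5] -/
theorem nonempty_translateTensorDual_iso_of_over
    (π : (A.fibre (Spec.map (CommRingCat.ofHom (algebraMap K Ω)))).toAbelianVariety.X.left ⟶
      A.toAffine.toAbelianVariety.X.left)
    (hπ : π = pullback.fst A.X.hom (Spec.map (CommRingCat.ofHom (algebraMap K Ω))))
    {Θ₁ : CartierDivisor (A.fibre (𝟙 (Spec (.of K)))).toAbelianVariety.X.left}
    (h₁ : A.IsLambdaOfAt (𝟙 (Spec (.of K))) D lam Θ₁)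
    {Θ : CartierDivisor (A.fibre (Spec.map (CommRingCat.ofHom (algebraMap K Ω)))).toAbelianVariety.X.left}
    (h : A.IsLambdaOfAt (Spec.map (CommRingCat.ofHom (algebraMap K Ω))) D lam Θ)
    {Θ' : CartierDivisor (A.fibre (Spec.map (CommRingCat.ofHom (algebraMap K Ω)))).toAbelianVariety.X.left}
    (hΘ' : Θ'.cechClass = CechPic.pullback (π ≫ AbelianVariety.Hom.toSchemeHom (fibreIdIso A).inv) Θ₁.cechClass)
    (Q : (A.fibre (Spec.map (CommRingCat.ofHom (algebraMap K Ω)))).toAbelianVariety.Points Ω)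
    (Q₁ : (A.fibre (𝟙 (Spec (.of K)))).toAbelianVariety.Points K)
    (hQ : Q.left ≫ pullback.fst A.X.hom (Spec.map (CommRingCat.ofHom (algebraMap K Ω))) =
      Spec.map (CommRingCat.ofHom (algebraMap K Ω)) ≫ (AlgPoints.map (fibreIdIso A).hom.hom.hom.hom Q₁).left) :
    Nonempty (tensorObj
        ((Scheme.Modules.pullback ((A.fibre (Spec.map (CommRingCat.ofHom (algebraMap K Ω)))).toAbelianVariety.translation
          Q).left).obj (lineBundle Θ.toUnitCocycle)) (Modules.dual (lineBundle Θ.toUnitCocycle)) ≅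
      tensorObj
        ((Scheme.Modules.pullback ((A.fibre (Spec.map (CommRingCat.ofHom (algebraMap K Ω)))).toAbelianVariety.translation
          Q).left).obj (lineBundle Θ'.toUnitCocycle)) (Modules.dual (lineBundle Θ'.toUnitCocycle))) := by
  -- ranks
  have hrΘ : HasRank (tensorObj
      ((Scheme.Modules.pullback ((A.fibre (Spec.map (CommRingCat.ofHom (algebraMap K Ω)))).toAbelianVariety.translation
        Q).left).obj (A.lineBundleOfDivisor _ Θ)) (Modules.dual (A.lineBundleOfDivisor _ Θ))) 1 :=
    hasRank_tensorObj_one (hasRank_pullback _ (A.hasRank_lineBundleOfDivisor _ Θ))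
      (hasRank_dual (A.hasRank_lineBundleOfDivisor _ Θ))
  have hrΘ' : HasRank (tensorObj
      ((Scheme.Modules.pullback ((A.fibre (Spec.map (CommRingCat.ofHom (algebraMap K Ω)))).toAbelianVariety.translation
        Q).left).obj (A.lineBundleOfDivisor _ Θ')) (Modules.dual (A.lineBundleOfDivisor _ Θ'))) 1 :=
    hasRank_tensorObj_one (hasRank_pullback _ (A.hasRank_lineBundleOfDivisor _ Θ'))
      (hasRank_dual (A.hasRank_lineBundleOfDivisor _ Θ'))
  have hl : HasRank ((Scheme.Modules.pullback
      (A.sliceAt (Spec.map (CommRingCat.ofHom (algebraMap K Ω))) D lam Q)).obj D.P) 1 :=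
    hasRank_pullback _ D.hasRank_one
  have hl₁ : HasRank ((Scheme.Modules.pullback (A.sliceAt (𝟙 (Spec (.of K))) D lam Q₁)).obj D.P) 1 :=
    hasRank_pullback _ D.hasRank_one
  have hr₁ : HasRank (tensorObj
      ((Scheme.Modules.pullback ((A.fibre (𝟙 (Spec (.of K)))).toAbelianVariety.translation Q₁).left).obj
        (A.lineBundleOfDivisor (𝟙 (Spec (.of K))) Θ₁))
      (Modules.dual (A.lineBundleOfDivisor (𝟙 (Spec (.of K))) Θ₁))) 1 :=
    hasRank_tensorObj_one (hasRank_pullback _ (A.hasRank_lineBundleOfDivisor _ Θ₁))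
      (hasRank_dual (A.hasRank_lineBundleOfDivisor _ Θ₁))
  refine (nonempty_iso_iff_detClass_eq hrΘ hrΘ' (HasRank.isFiniteLocallyFree' hrΘ)
    (HasRank.isFiniteLocallyFree' hrΘ')).2 ?_
  -- `[TTD Θ Q] = [𝒫|slice_s Q]` (λ̄ = Λ(𝒪(Θ)) at `s`)
  obtain ⟨i⟩ := h Q
  have e1 : detClass (HasRank.isFiniteLocallyFree' hrΘ) = detClass (HasRank.isFiniteLocallyFree' hl) :=
    (detClass_eq_of_iso i _ _).symm
  -- `[𝒫|slice_s Q] = π₁^*[𝒫|slice_𝟙 Q₁]`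
  have e2 : detClass (HasRank.isFiniteLocallyFree' hl) =
      CechPic.pullback (π ≫ AbelianVariety.Hom.toSchemeHom (fibreIdIso A).inv)
        (detClass (HasRank.isFiniteLocallyFree' hl₁)) :=
    A.detClass_slicePullback_eq_of_over D lam π hπ Q Q₁ hQ _ _
  -- `[𝒫|slice_𝟙 Q₁] = t_{Q₁}^*[Θ₁]·[Θ₁]⁻¹` (λ̄ = Λ(𝒪(Θ₁)) at `𝟙`)
  obtain ⟨i₁⟩ := h₁ Q₁
  have e3 : detClass (HasRank.isFiniteLocallyFree' hl₁) =
      CechPic.pullback ((A.fibre (𝟙 (Spec (.of K)))).toAbelianVariety.translation Q₁).left Θ₁.cechClass *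
        (Θ₁.cechClass)⁻¹ :=
    (detClass_eq_of_iso i₁ _ (HasRank.isFiniteLocallyFree' hr₁)).trans
      (A.detClass_translationPullback_tensor_dual _ Θ₁ Q₁ _)
  -- `[TTD Θ' Q] = t_Q^*[Θ']·[Θ']⁻¹`
  have e4 : detClass (HasRank.isFiniteLocallyFree' hrΘ') =
      CechPic.pullback ((A.fibre (Spec.map (CommRingCat.ofHom (algebraMap K Ω)))).toAbelianVariety.translation Q).left
        Θ'.cechClass * (Θ'.cechClass)⁻¹ :=
    A.detClass_translationPullback_tensor_dual _ Θ' Q _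
  -- the translation square `t_Q ≫ π₁ = π₁ ≫ t_{Q₁}`
  have hnat := A.translation_left_comp_pi π hπ Q Q₁ hQ
  refine e1.trans (e2.trans ((congrArg _ e3).trans ?_))
  rw [map_mul, map_inv, ← cechPic_pullback_comp', ← hnat, cechPic_pullback_comp', ← hΘ']
  exact e4.symm

end Slice

/-! ### §4–§5. The pairing and the head -/

section Head

variable {A} {g N : ℕ} {φ : A.LevelStructure g N} (D : A.DualPair) (lam : A.X ⟶ D.hat.X) {δ : Fin g → ℕ}
  {Θ₁ : CartierDivisor (A.fibre (𝟙 (Spec (.of K)))).toAbelianVariety.X.left}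

/-- **THE CORE (algebra form): a symplectic lift at the identity point yields one at `Spec (K → Ω)`** for every
`Λ(𝒪(·))`-witness `Θ` there.  Roots `ζ′_M := (K → Ω)(ζ_M)`; tower `lift′_M := T ∘ lift_M` for a transport `T` of §1
(bijective onto `A_s[M](Ω)` by §2; level `N` by the reading of sections §1; compatible because `T` is a
homomorphism); pairing: `ē^Θ_M(T P₁, T Q₁) = ē^{Θ_Ω}_M(T P₁, T Q₁)` (§3 + ★ the dictionary
`weilPairingLevel_eq_of_nonempty_translateTensorDual_iso`) `= (K → Ω)(ē^{(e⁻¹)^*Θ₁}_M(e P₁, e Q₁))`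
(★ `weilPairingLevel_baseChange`, §0) `= (K → Ω)(ē^{Θ₁}_M(P₁, Q₁))` (★ `weilPairingLevel_pullback_eq`)
`= ζ′_M ^ E_δ(x, y)`, where `Θ_Ω := π^*((e⁻¹)^*Θ₁)`. [cite: Lan2013PELCompactifications, §1.3.6 Lemma 1.3.6.5 and Lemma 1.3.6.6 (pp. 81–82)]
[cite: Milne1986AbelianVarieties, §16 (p. 131, the pairings ē_m)] [cite: MumfordAV1970, §20 (p. 186)] -/
theorem LevelStructure.SymplecticLift.nonempty_algebraMap [IsAlgClosed K] [CharZero K]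
    (h₁ : A.IsLambdaOfAt (𝟙 (Spec (.of K))) D lam Θ₁) (Λ₁ : φ.SymplecticLift (𝟙 (Spec (.of K))) Θ₁ δ)
    (Ω : Type) [Field Ω] [Algebra K Ω] [IsAlgClosed Ω]
    {Θ : CartierDivisor (A.fibre (Spec.map (CommRingCat.ofHom (algebraMap K Ω)))).toAbelianVariety.X.left}
    (h : A.IsLambdaOfAt (Spec.map (CommRingCat.ofHom (algebraMap K Ω))) D lam Θ) :
    Nonempty (φ.SymplecticLift (Spec.map (CommRingCat.ofHom (algebraMap K Ω))) Θ δ) := by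
  classical
  -- the three abelian varieties: `A₀` (the scheme itself), `A₁` (identity fibre), `As` (fibre at `Spec (K → Ω)`)
  let A₀ := A.toAffine.toAbelianVariety
  let A₁ := (A.fibre (𝟙 (Spec (.of K)))).toAbelianVariety
  let As := (A.fibre (Spec.map (CommRingCat.ofHom (algebraMap K Ω)))).toAbelianVariety
  -- the projection `π : As → A₀`, typed on the abelian varieties (instance search), and the divisor `Θ_Ω`
  obtain ⟨π, hπ⟩ : ∃ π : As.X.left ⟶ A₀.X.left,
      π = pullback.fst A.X.hom (Spec.map (CommRingCat.ofHom (algebraMap K Ω))) := ⟨_, rfl⟩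
  haveI : IsDominant π := A.isDominant_fibreFst Ω π hπ
  haveI : @IsDominant (A₀.baseChange Ω).X.left A₀.X.left π := A.isDominant_fibreFst Ω π hπ
  haveI := A.isDominant_toSchemeHom_fibreIdIso_inv
  let Θ₀ : CartierDivisor A₀.X.left := Θ₁.pullback (AbelianVariety.Hom.toSchemeHom (fibreIdIso A).inv)
  let ΘΩ : CartierDivisor As.X.left := Θ₀.pullback π
  have hΘΩ : ΘΩ.cechClass = CechPic.pullback (π ≫ AbelianVariety.Hom.toSchemeHom (fibreIdIso A).inv) Θ₁.cechClass := by
    rw [cechPic_pullback_comp', ← CartierDivisor.cechClass_pullback, ← CartierDivisor.cechClass_pullback]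
  -- the transport of points and its restriction to the torsion
  obtain ⟨T, hTinj, hT⟩ := A.exists_transport Ω
  let TM : ∀ M : ℕ, A₁.torsionPoints K (M : ℤ) →* As.torsionPoints Ω (M : ℤ) := fun M =>
    (T.comp (A₁.torsionPoints K (M : ℤ)).subtype).codRestrict _ fun P => A.transport_mem_torsionPoints T P.2
  have hTM : ∀ (M : ℕ) (P : A₁.torsionPoints K (M : ℤ)), ((TM M P : As.torsionPoints Ω (M : ℤ)) : As.Points Ω) = T P :=
    fun M P => rfl
  refine ⟨{ ζ := fun M => algebraMap K Ω (Λ₁.ζ M)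
            isPrimitiveRoot_ζ := fun M hM hM₀ =>
              (Λ₁.isPrimitiveRoot_ζ hM hM₀).map_of_injective (algebraMap K Ω).injective
            ζ_pow := fun M k hM hM₀ hk => by rw [← map_pow, Λ₁.ζ_pow k hM hM₀ hk]
            lift := fun M => (TM M).comp (Λ₁.lift M)
            lift_bijective := ?_
            lift_compat := ?_
            lift_level := ?_
            pairing := ?_ }⟩
  · -- bijective: injective between finite sets with `#A_s[M](Ω) ≤ M^{2g}` (§2)
    intro M hM hM₀
    haveI : NeZero M := ⟨hM₀⟩
    have hinj : Function.Injective ((TM M).comp (Λ₁.lift M)) := by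
      intro a b hab
      have hab' : T (Λ₁.lift M a) = T (Λ₁.lift M b) := by
        rw [← hTM, ← hTM]
        exact congrArg Subtype.val hab
      exact (Λ₁.lift_bijective hM hM₀).1 (Subtype.ext (hTinj hab'))
    haveI : Finite (As.torsionPoints Ω (M : ℤ)) := by
      apply Nat.finite_of_card_ne_zero
      rw [A.natCard_torsionPoints_fibre_eq hM₀]
      exact pow_ne_zero _ hM₀
    refine hinj.bijective_of_nat_card_le ?_
    rw [Nat.card_eq_fintype_card (α := Multiplicative (Fin g ⊕ Fin g → ZMod M)), Fintype.card_multiplicative,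
      Fintype.card_fun, ZMod.card, Fintype.card_sum, Fintype.card_fin, ← two_mul]
    exact natCard_torsionPoints_fibre_le Λ₁ hM hM₀
  · -- tower compatibility: `T` is a homomorphism
    intro M k x hM hM₀ hk
    change T _ = (T _ : As.Points Ω) ^ k
    rw [← map_pow]
    exact congrArg T (Λ₁.lift_compat k x hM hM₀ hk)
  · -- level `N`: `T(σᵢ(𝟙)) = σᵢ(s)`
    intro i
    change T ((Λ₁.lift N (Multiplicative.ofAdd (Pi.single i 1)) : A₁.torsionPoints K (N : ℤ)) : A₁.Points K) = _
    rw [Λ₁.lift_level i]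
    exact A.transport_restrictPt_id T hT (φ.σ i)
  · -- the pairing clause
    intro M hM hMΩ x y
    have hM₀ : M ≠ 0 := by rintro rfl; exact hMΩ (by simp)
    have hMK : (M : K) ≠ 0 := by exact_mod_cast hM₀
    haveI iK := AbelianVariety.isDominant_toSchemeHom_zsmul_of_ne_zero A₁ hMK
    haveI i₀ := AbelianVariety.isDominant_toSchemeHom_zsmul_of_ne_zero A₀ hMK
    haveI iΩ := AbelianVariety.isDominant_toSchemeHom_zsmul_of_ne_zero As hMΩ
    haveI iΩ' := AbelianVariety.isDominant_toSchemeHom_zsmul_of_ne_zero (A₀.baseChange Ω) hMΩ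
    -- the points
    let P₁ : A₁.torsionPoints K (M : ℤ) := Λ₁.lift M (Multiplicative.ofAdd x)
    let Q₁ : A₁.torsionPoints K (M : ℤ) := Λ₁.lift M (Multiplicative.ofAdd y)
    let P₀ : A₀.torsionPoints K (M : ℤ) :=
      ⟨AlgPoints.map (fibreIdIso A).hom.hom.hom.hom P₁.1, AbelianVariety.map_mem_torsionPoints _ P₁.2⟩
    let Q₀ : A₀.torsionPoints K (M : ℤ) :=
      ⟨AlgPoints.map (fibreIdIso A).hom.hom.hom.hom Q₁.1, AbelianVariety.map_mem_torsionPoints _ Q₁.2⟩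
    have hPπ : ((TM M P₁ : As.torsionPoints Ω (M : ℤ)) : As.Points Ω).left ≫ π =
        AbelianVariety.bcSpec K Ω ≫ (P₀ : A₀.Points K).left := by
      rw [hTM, hπ]; exact hT P₁.1
    have hQπ : ((TM M Q₁ : As.torsionPoints Ω (M : ℤ)) : As.Points Ω).left ≫ π =
        AbelianVariety.bcSpec K Ω ≫ (Q₀ : A₀.Points K).left := by
      rw [hTM, hπ]; exact hT Q₁.1
    -- (i) witness change at `s`: `ē^Θ = ē^{Θ_Ω}` on `(T P₁, T Q₁)`
    have step1 : As.weilPairingLevel Θ (TM M P₁) (TM M Q₁) = As.weilPairingLevel ΘΩ (TM M P₁) (TM M Q₁) :=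
      weilPairingLevel_eq_of_nonempty_translateTensorDual_iso As (Q₁ := TM M Q₁) (Q₂ := TM M Q₁)
        (nonempty_translateTensorDual_iso_of_over D lam π hπ h₁ h hΘΩ (T Q₁.1) Q₁.1 (hT Q₁.1)) (TM M P₁)
    -- (ii) base change: `ē^{Θ_Ω}(T P₁, T Q₁) = (K → Ω)(ē^{Θ₀}(e P₁, e Q₁))`
    have step2 : As.weilPairingLevel ΘΩ (TM M P₁) (TM M Q₁) = algebraMap K Ω (A₀.weilPairingLevel Θ₀ P₀ Q₀) :=
      A₀.weilPairingLevel_baseChange Ω π hπ Θ₀ P₀ Q₀ (TM M P₁) (TM M Q₁) hPπ hQπ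
    -- (iii) along `e⁻¹`: `ē^{(e⁻¹)^*Θ₁}(e P₁, e Q₁) = ē^{Θ₁}(P₁, Q₁)`
    have step3 : A₀.weilPairingLevel Θ₀ P₀ Q₀ = A₁.weilPairingLevel Θ₁ P₁ Q₁ :=
      AbelianVariety.weilPairingLevel_pullback_eq (fibreIdIso A).inv Θ₁ P₀ Q₀ P₁ Q₁
        (A.map_fibreIdIso_inv_map_hom P₁.1).symm (A.map_fibreIdIso_inv_map_hom Q₁.1).symm
    -- (iv) the lift `Λ₁` is symplectic at `𝟙`
    have step4 : A₁.weilPairingLevel Θ₁ P₁ Q₁ = Λ₁.ζ M ^ (typeFormMod δ M x y).val :=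
      Λ₁.weilPairingLevel_lift hM hMK x y
    have key : As.weilPairingLevel Θ (TM M P₁) (TM M Q₁) = algebraMap K Ω (Λ₁.ζ M) ^ (typeFormMod δ M x y).val := by
      rw [step1, step2, step3, step4, map_pow]
    exact key

/-- **A SYMPLECTIC LIFT AT THE IDENTITY POINT GIVES ONE AT EVERY GEOMETRIC POINT, FOR EVERY WITNESS**
([Lan2013PELCompactifications] Lemma 1.3.6.5 «there exists (noncanonically) a symplectic isomorphism lifting
`α_{n,s̄}`» is a statement about the geometric fibre, and over `K = K̄` of characteristic `0` the torsion, the level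
sections and the pairings of every geometric fibre `A_s`, `s : Spec Ω → Spec K`, come from `A_𝟙` by base change —
[Milne1986AbelianVarieties] §16: `ē_N` commutes with base change; two `Λ(𝒪(·))`-witnesses of the same `λ̄` have the
same pairing on torsion points): given `λ̄ = Λ(𝒪(Θ₁))` at `𝟙` and a lift `Λ₁` of `φ(𝟙)` for `Θ₁`, for every
algebraically closed `Ω`, every `s : Spec Ω → Spec K` and every `Θ` with `λ̄ = Λ(𝒪(Θ))` at `s` there is a symplectic
lift of `φ(s)` for `Θ` (`s = Spec (K → Ω)` by Mathlib `Spec.map_surjective`, then `nonempty_algebraMap`).  No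
ampleness is used. [cite: Lan2013PELCompactifications, §1.3.6 Lemma 1.3.6.5 and Lemma 1.3.6.6 (pp. 81–82)]
[cite: Milne1986AbelianVarieties, §16 (p. 131, the pairings ē_m)] -/
theorem LevelStructure.SymplecticLift.nonempty_of_identityFibre [IsAlgClosed K] [CharZero K]
    (h₁ : A.IsLambdaOfAt (𝟙 (Spec (.of K))) D lam Θ₁) (Λ₁ : φ.SymplecticLift (𝟙 (Spec (.of K))) Θ₁ δ)
    {Ω : Type} [Field Ω] [IsAlgClosed Ω] (s : Spec (.of Ω) ⟶ Spec (.of K))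
    {Θ : CartierDivisor (A.fibre s).toAbelianVariety.X.left} (h : A.IsLambdaOfAt s D lam Θ) :
    Nonempty (φ.SymplecticLift s Θ δ) := by
  obtain ⟨f, rfl⟩ := Spec.map_surjective s
  letI : Algebra K Ω := f.hom.toAlgebra
  exact LevelStructure.SymplecticLift.nonempty_algebraMap D lam h₁ Λ₁ Ω h

/-- **SYMPLECTIC-LIFTABILITY IS DECIDED AT THE IDENTITY POINT** (D3 `IsSymplecticLiftable`, [Lan2013PELCompactifications]
Def. 1.3.6.2 via Lemma 1.3.6.6): over `K = K̄` of characteristic `0`, if at the identity point of `Spec K` there are a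
`Λ(𝒪(·))`-witness `Θ₁` of the polarisation `λ` and a symplectic lift of `φ(𝟙)` for `Θ₁` of type `δ`, then `φ` is
symplectic-liftable of type `δ` for `λ` — at every geometric point and for every ample witness.  The consumer (U-a)
obtains the lift at `𝟙` from ★ (b) `SiegelAdelicMarking.exists_symplecticLift_of_levelReading` over the sections of
★ `LevelStructureOfTorsionBasis`. [cite: Lan2013PELCompactifications, §1.3.6 Def. 1.3.6.2 (p. 80), Lemma 1.3.6.5 and Lemma 1.3.6.6 (pp. 81–82)]
[cite: Deligne1971TravauxShimura, 4.12 (b) p. 149] -/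
theorem LevelStructure.isSymplecticLiftable_of_identityFibre [IsAlgClosed K] [CharZero K] (pol : A.Polarization D)
    (h₁ : A.IsLambdaOfAt (𝟙 (Spec (.of K))) D pol.lam Θ₁) (hΛ : Nonempty (φ.SymplecticLift (𝟙 (Spec (.of K))) Θ₁ δ)) :
    φ.IsSymplecticLiftable pol δ := by
  obtain ⟨Λ₁⟩ := hΛ
  intro Ω _ _ s Θ _ h
  exact LevelStructure.SymplecticLift.nonempty_of_identityFibre D pol.lam h₁ Λ₁ s h

end Head

end AbelianSchemeOver

end Literature.AlgebraicGeometry.AbelianSchemes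

end
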